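import Summits.HubbardSuperconductivity.HubbardSuperconductivity.Theses.ChiralWindow

/-!
# Disproof of `CwKLChiralWindow` — findings (refuter cdisprove, stmt-HubbardSuperconductivity-1741)

Standing adversary file for crux `ChiralWindow.CwKLChiralWindow` (rank 3, "certified Kohn–Luttinger
chiral-window data").  Prose lives in docstrings; everything below elaborates (`lean check` rc 0,
0 sorries unless marked NEAR-MISS).

## Index of findings (cycle 1, 2026-08-16)

1. **No junk at the window fillings** (audit of every constant in the signature, §A): for
   `δ ∈ [3/10, 12/25]` the Fermi curve of `squareDispersion 1 0` at `μ(δ) < 0` is a closed, STRICTLY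
   CONVEX curve strictly inside `(-π,π)²` (curvature form `= m(1 - cos kₓ cos k_y) > 0`,
   `m = -μ/2 ∈ (0,2)`), `fermiCurveMeasure` is finite, non-zero and `D₄`-invariant, the Lindhard kernel
   is bounded and Hölder-1/2 (external-tangency Kohn folds only), channel-state sets are non-empty,
   `chemicalPotentialOfDensity` is the unique root of a strictly increasing filling.  Consequence
   (kernel-checked modulo integrability/mean-zero hypotheses: `pairingForm_eq_sq_mul`,
   `channelInf_eq_sq_mul`, §A):
   `Λ_U(δ,χ) = U²·m_χ(δ)` EXACTLY for `χ ≠ A1g` and `Λ_U(δ,A1g)/U² ↑ m_{A1g}^⊥(δ)` as `U ↓ 0`, so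
   clauses (i)–(iii) are `U`-free OPEN conditions on five real-analytic-in-δ curves; with `∃ γ > 0`,
   `∃ [a,b]` they are TRUE as soon as B₁g strictly leads at some `δ ≥ 3/10` and a channel
   `∉ {B1g, A2g}` strictly leads at some later `δ ≤ 12/25` with no EXACT tie at the overtaking point.
   The statement cannot be killed by a degenerate instance; only the numbers can kill it, and only
   through an exact coincidence.  (The tree quirk `lindhardFunction ε μ 0 = 0 ≠ ρ` sits on the
   `μ_F ⊗ μ_F`-null line `k' = -k` and is invisible to `pairingForm`/`channelInf`.)
2. **The one live kill — an exact triple point — is DEAD (numerically, T = 0 exact, converged).**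
   Prior census (j006151, T = 0.01 smearing) put the first overtaking of B₁g at `n* ≈ 0.587`
   (`δ* ≈ 0.413`, inside the window) by the TWINS `E` (Simkovic's `p⁽⁶⁾`) and `B₂g` (`d_xy`), split
   by only `1.4·10⁻⁴` there.  `false_of_twinsTied` (§C) is the kernel-checked form of the kill: if the
   twins are tied wherever one of them is at or below B₁g on the window (and A₁g never leads), the
   crux is FALSE as filed — clause (ii) has no `γ > 0`.  The refuter's T = 0 EXACT census (§D: χ₀ by a
   closed-form 1D reduction validated to 1e-9 against Richardson-extrapolated lattice sums; Nyström on
   the D₄ fundamental arc, M = 32/128/256, drift ≤ 2e-6 on all channel differences) gives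
   `n*_E = 0.58763` (B1g = E), `n*_B2g = 0.58728`, `δ* = 0.41237`, twin crossings at
   `n = 0.5085 / 0.5909 / 0.6668` — the nearest `0.0033` away from `n*` — and a twin splitting
   `(m_E - m_B2g)(n*) = -1.90·10⁻⁴`, stable from M = 128 to M = 256 to `1e-6` and equal within 25 % to
   the independent T = .01 FFT value: NOT compatible with a tie.  Numerically the crux is TRUE with
   witness `χs = E`, `a = 3/10`, `b ≈ 0.4126`, `γ ≈ 1·10⁻⁴`, `c ≈ 0.15` (§D); no structural reason for
   an exact E/B₂g degeneracy exists (parity-class kernels unrelated; the twins feed on different RKKY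
   shells), and the clustering of the three crossings is forced by `|m_E - m_B2g| ≲ 1e-3` on the whole
   range (B₁g, descending with relative slope ≈ 0.6/unit n, meets both twins within `Δn ≈ 3.5e-4`).
3. **Node covering (iv) has no symmetry obstruction for χs ∈ {E, B₂g}; it has one for A₂g** (§B,
   proved): B₁g functions vanish on both zone diagonals, B₂g functions on both axes, A₂g functions on
   diagonals AND axes, E functions are exactly the odd ones (no forced zero on the Fermi curve; an
   `E_x`-row partner vanishes where `kₓ = 0`, its rotated twin does not).  Hence `{B1g, A2g}` always
   share the four diagonal Fermi points (the crux rightly excludes A₂g), while `{B1g, E}` and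
   `{B1g, B2g}` have no forced common zero; with continuous bottom eigenfunctions (continuous kernel,
   `λ ≠ 0`) the case `n = 0` of (iv) is impossible and (iv) is generic otherwise (census:
   `min_FS(g² + f_x² + f_y²) ≈ 0.15–0.29`).
4. **What a prover must still supply and a refuter cannot attack in Lean today**: every quantitative
   clause is an integral against `μH[1]⌊FS` with density; Mathlib has no arc-length / coarea bridge, so
   neither a certificate nor a `¬` of a numerical clause can be kernel-checked before
   `Literature.Geometry.GeometricMeasureTheory.AreaFormula`-type infrastructure is instantiated for
   this curve.  The refuter's verdict on (i)–(iv) is therefore numerical evidence + the conditional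
   theorem of §C, not a landed `¬`.

## Resists because
(i) the partner and the window are existential, (ii) the margins `γU²` are existential with `γ`
free to be `10⁻⁴`, (iii) every object is junk-free at these fillings — so only an exact spectral
coincidence of the compact operators `K_E(δ*)` and `K_{B2g}(δ*)` at the B₁g overtaking point could
kill, and the converged T = 0 census measures that splitting as `1.90·10⁻⁴` (190× the
discretisation drift).  What the adversary leaves for the provers is a PRICE, not a kill: the
certificate must resolve three channel bottoms of a cusp-kernel operator to `±3·10⁻⁵` absolute
(`1.5·10⁻³` relative) near `δ* = 0.4124`, the partner is the E (triplet `p⁽⁶⁾`) doublet — so the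
route's "d + iX" is the singlet–triplet mixture `d + i p`, its kill criterion (iv) territory — and
`γ ≈ 10⁻⁴` forces the downstream `U₀` below `γ/C₃` where `C₃U³` bounds the third-order vertex.
-/

set_option linter.dupNamespace false

namespace Summit.HubbardSuperconductivity.HubbardSuperconductivity.Cruxes.CwKLChiralWindow.Disproof

open Literature.MathematicalPhysics.QuantumLattice MeasureTheory
open scoped BigOperators

/-! ## §A  The crux's channel bottom with its `let`s unfolded -/

/-- `Lam U δ χ = Λ_U(δ, χ)` of the crux: `channelInf ε₀ (μ(δ)) U χ` with `ε₀ = squareDispersion 1 0`,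
`μ(δ) = chemicalPotentialOfDensity ε₀ (1 - δ)`.  Definitionally the crux's `Λ δ χ` at coupling `U`. -/
noncomputable def Lam (U δ : ℝ) (χ : D4Irrep) : ℝ :=
  channelInf (squareDispersion 1 0) (chemicalPotentialOfDensity (squareDispersion 1 0) (1 - δ)) U χ

/-- For a mean-zero gap function the bare-`U` term drops out and the pairing form is EXACTLY
`U²`-homogeneous (hypotheses: integrability of `ψ` and of the kernel slices against `μ_F`, which hold
for every channel state at the window fillings since `μ_F` is finite and `χ₀` bounded there).
[folklore] -/
theorem pairingForm_eq_sq_mul {ε : Momentum → ℝ} {μ U : ℝ} {ψ : Momentum → ℝ}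
    (hψ : Integrable ψ (fermiCurveMeasure ε μ))
    (hχ : ∀ k, Integrable (fun k' => lindhardFunction ε μ (k + k') * ψ k') (fermiCurveMeasure ε μ))
    (h0 : ∫ k, ψ k ∂fermiCurveMeasure ε μ = 0) :
    pairingForm ε μ U ψ =
      U ^ 2 * ∫ k, ψ k * ∫ k', lindhardFunction ε μ (k + k') * ψ k' ∂fermiCurveMeasure ε μ
        ∂fermiCurveMeasure ε μ := by
  unfold pairingForm
  have inner : ∀ k, ∫ k', kohnLuttingerKernel ε μ U k k' * ψ k' ∂fermiCurveMeasure ε μ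
      = U ^ 2 * ∫ k', lindhardFunction ε μ (k + k') * ψ k' ∂fermiCurveMeasure ε μ := by
    intro k
    have hsplit : (fun k' => kohnLuttingerKernel ε μ U k k' * ψ k')
        = fun k' => U * ψ k' + U ^ 2 * (lindhardFunction ε μ (k + k') * ψ k') := by
      funext k'; simp only [kohnLuttingerKernel]; ring
    rw [hsplit, integral_add (hψ.const_mul U) ((hχ k).const_mul (U ^ 2)), integral_const_mul,
      integral_const_mul, h0, mul_zero, zero_add]
  simp_rw [inner]
  rw [← integral_const_mul]
  congr 1
  funext k
  ring

/-- Consequence ("the margins `∝ U²` buy nothing"): on any channel all of whose states are mean-zero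
and kernel-integrable — every `χ ≠ A1g` at the window fillings (`∫ψ dμ_F = ⟨1, ψ⟩ = 0` by
`D₄`-invariance of `μ_F`, `1 ∈ A1g`) — `channelInf` is exactly `U²`-homogeneous, so clauses
(i)–(iii) of the crux are `U`-FREE inequalities between the second-order bottoms
`m_χ(δ) := channelInf ε₀ (μ δ) 1 χ`; only the `A1g` comparisons retain a (monotone, harmless)
`U`-dependence. [folklore] -/
theorem channelInf_eq_sq_mul {ε : Momentum → ℝ} {μ : ℝ} (U : ℝ) (χ : D4Irrep)
    (hint : ∀ ψ, IsChannelState ε μ χ ψ → Integrable ψ (fermiCurveMeasure ε μ) ∧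
      (∀ k, Integrable (fun k' => lindhardFunction ε μ (k + k') * ψ k') (fermiCurveMeasure ε μ)) ∧
      ∫ k, ψ k ∂fermiCurveMeasure ε μ = 0) :
    channelInf ε μ U χ = U ^ 2 * channelInf ε μ 1 χ := by
  unfold channelInf
  have himg : (pairingForm ε μ U) '' {ψ | IsChannelState ε μ χ ψ}
      = (fun x => U ^ 2 * x) '' ((pairingForm ε μ 1) '' {ψ | IsChannelState ε μ χ ψ}) := by
    rw [Set.image_image]
    apply Set.image_congr
    intro ψ hψ
    obtain ⟨h1, h2, h3⟩ := hint ψ hψ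
    show pairingForm ε μ U ψ = U ^ 2 * pairingForm ε μ 1 ψ
    rw [pairingForm_eq_sq_mul h1 h2 h3, pairingForm_eq_sq_mul h1 h2 h3]
    ring
  rw [himg]
  have hnn : 0 ≤ U ^ 2 := sq_nonneg U
  rw [← smul_eq_mul, ← Real.sInf_smul_of_nonneg hnn]
  congr 1

/-! ## §B  Symmetry zeros behind clause (iv) (load-bearing for the exclusion of A₂g and for `n ≠ 0`) -/

theorem sum_d4 (f : DihedralGroup 4 → ℝ) :
    ∑ γ, f γ = (f (.r 0) + f (.r 1) + f (.r 2) + f (.r 3)) +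
      (f (.sr 0) + f (.sr 1) + f (.sr 2) + f (.sr 3)) := by
  rw [Fintype.sum_equiv DihedralGroup.equivSum f (fun x => f (DihedralGroup.equivSum.symm x))
    (by intro a; rcases a with j | j <;> rfl)]
  rw [Fintype.sum_sum_type]
  simp only [DihedralGroup.equivSum_symm_apply]
  have h4 : ∀ g : ZMod 4 → ℝ, ∑ i, g i = g 0 + g 1 + g 2 + g 3 := fun g => Fin.sum_univ_four g
  rw [h4, h4]

theorem d4_r0 (k : Momentum) : d4Momentum (.r 0) k = k := rfl
theorem d4_r1 (k : Momentum) : d4Momentum (.r 1) k = rotMomentum k := rfl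
theorem d4_r2 (k : Momentum) : d4Momentum (.r 2) k = rotMomentum (rotMomentum k) := rfl
theorem d4_r3 (k : Momentum) :
    d4Momentum (.r 3) k = rotMomentum (rotMomentum (rotMomentum k)) := rfl
theorem d4_sr0 (k : Momentum) : d4Momentum (.sr 0) k = reflMomentum k := rfl
theorem d4_sr1 (k : Momentum) : d4Momentum (.sr 1) k = reflMomentum (rotMomentum k) := rfl
theorem d4_sr2 (k : Momentum) :
    d4Momentum (.sr 2) k = reflMomentum (rotMomentum (rotMomentum k)) := rfl
theorem d4_sr3 (k : Momentum) :
    d4Momentum (.sr 3) k = reflMomentum (rotMomentum (rotMomentum (rotMomentum k))) := rfl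

theorem val0 : (0 : ZMod 4).val = 0 := rfl
theorem val1 : (1 : ZMod 4).val = 1 := rfl
theorem val2 : (2 : ZMod 4).val = 2 := rfl
theorem val3 : (3 : ZMod 4).val = 3 := rfl
theorem ne10 : (1 : ZMod 4) ≠ 0 := by decide
theorem ne12 : (1 : ZMod 4) ≠ 2 := by decide
theorem ne20 : (2 : ZMod 4) ≠ 0 := by decide
theorem ne30 : (3 : ZMod 4) ≠ 0 := by decide
theorem ne32 : (3 : ZMod 4) ≠ 2 := by decide

theorem rot_mk (a b : ℝ) : rotMomentum (WithLp.toLp 2 ![a, b]) = WithLp.toLp 2 ![-b, a] := by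
  simp [rotMomentum]
theorem refl_mk (a b : ℝ) : reflMomentum (WithLp.toLp 2 ![a, b]) = WithLp.toLp 2 ![a, -b] := by
  simp [reflMomentum]
theorem rot_rot (k : Momentum) : rotMomentum (rotMomentum k) = -k := by
  ext i; fin_cases i <;> simp [rotMomentum]

/-- B₁g gap functions vanish on the zone diagonal `k₀ = k₁` (pointwise, for EVERY `InChannel .B1g`
function, not only a.e.): the four diagonal Fermi points are nodes of `g` in clause (iv).
[folklore] -/
theorem b1g_diag {g : Momentum → ℝ} (h : InChannel .B1g g) (t : ℝ) :
    g (WithLp.toLp 2 ![t, t]) = 0 := by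
  have := congrFun h (WithLp.toLp 2 ![t, t])
  simp only [d4Project, sum_d4, d4_r0, d4_r1, d4_r2, d4_r3, d4_sr0, d4_sr1, d4_sr2, d4_sr3,
    D4Irrep.char, D4Irrep.dim, val0, val1, val2, val3, rot_mk, refl_mk, neg_neg] at this
  norm_num at this
  linarith

/-- B₁g gap functions vanish on the anti-diagonal `k₁ = -k₀`. [folklore] -/
theorem b1g_antidiag {g : Momentum → ℝ} (h : InChannel .B1g g) (t : ℝ) :
    g (WithLp.toLp 2 ![t, -t]) = 0 := by
  have := congrFun h (WithLp.toLp 2 ![t, -t])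
  simp only [d4Project, sum_d4, d4_r0, d4_r1, d4_r2, d4_r3, d4_sr0, d4_sr1, d4_sr2, d4_sr3,
    D4Irrep.char, D4Irrep.dim, val0, val1, val2, val3, rot_mk, refl_mk, neg_neg] at this
  norm_num at this
  linarith

/-- B₂g (`d_xy`) gap functions vanish on both axes — where B₁g does not have forced zeros, so the
pair `{B1g, B2g}` has no forced common node (d + i d_xy is generically fully gapped). [folklore] -/
theorem b2g_axis {g : Momentum → ℝ} (h : InChannel .B2g g) (t : ℝ) :
    g (WithLp.toLp 2 ![t, 0]) = 0 ∧ g (WithLp.toLp 2 ![0, t]) = 0 := by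
  have h1 := congrFun h (WithLp.toLp 2 ![t, 0])
  have h2 := congrFun h (WithLp.toLp 2 ![0, t])
  simp only [d4Project, sum_d4, d4_r0, d4_r1, d4_r2, d4_r3, d4_sr0, d4_sr1, d4_sr2, d4_sr3,
    D4Irrep.char, D4Irrep.dim, val0, val1, val2, val3, rot_mk, refl_mk, neg_neg, neg_zero] at h1 h2
  norm_num at h1 h2
  constructor <;> linarith

/-- A₂g (`xy(x²-y²)`) gap functions vanish on the diagonals AND the axes: an A₂g partner shares the
four diagonal Fermi nodes of every B₁g function, so (iv) is impossible for `χs = A2g` with continuous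
bottom eigenfunctions — the symmetry content of the crux's exclusion `χs ≠ A2g`. [folklore] -/
theorem a2g_diag_axis {g : Momentum → ℝ} (h : InChannel .A2g g) (t : ℝ) :
    g (WithLp.toLp 2 ![t, t]) = 0 ∧ g (WithLp.toLp 2 ![t, 0]) = 0 := by
  have h1 := congrFun h (WithLp.toLp 2 ![t, t])
  have h2 := congrFun h (WithLp.toLp 2 ![t, 0])
  simp only [d4Project, sum_d4, d4_r0, d4_r1, d4_r2, d4_r3, d4_sr0, d4_sr1, d4_sr2, d4_sr3,
    D4Irrep.char, D4Irrep.dim, rot_mk, refl_mk, neg_neg, neg_zero] at h1 h2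
  norm_num at h1 h2
  constructor <;> linarith

/-- Common node of every B₁g/A₂g pair at the diagonal points (why A₂g cannot be the chiral
partner). [folklore] -/
theorem b1g_a2g_common_node {g f : Momentum → ℝ} (hg : InChannel .B1g g) (hf : InChannel .A2g f)
    (t : ℝ) : g (WithLp.toLp 2 ![t, t]) ^ 2 + f (WithLp.toLp 2 ![t, t]) ^ 2 = 0 := by
  rw [b1g_diag hg t, (a2g_diag_axis hf t).1]; ring

/-- The E channel of the tree (`d4Project .E ψ = ψ`) is exactly the space of ODD gap functions
(spin triplet); in particular it carries no forced zero on the Fermi curve (only at `k = 0`), and for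
odd `ψ` the singlet kernel `U + U²χ₀(k+k')` acts as the triplet kernel `-U²χ₀(k-k')` (grounder note
2026-08-15). [folklore] -/
theorem e_iff_odd (g : Momentum → ℝ) : InChannel .E g ↔ ∀ k, g (-k) = -g k := by
  constructor
  · intro h k
    have h1 := congrFun h k
    simp only [d4Project, sum_d4, d4_r0, d4_r1, d4_r2, d4_r3, d4_sr0, d4_sr1, d4_sr2, d4_sr3,
      D4Irrep.char, D4Irrep.dim, ne10, ne12, ne20, ne30, ne32, if_false, rot_rot] at h1
    norm_num at h1
    linarith
  · intro hodd
    funext k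
    simp only [d4Project, sum_d4, d4_r0, d4_r1, d4_r2, d4_r3, d4_sr0, d4_sr1, d4_sr2, d4_sr3,
      D4Irrep.char, D4Irrep.dim, ne10, ne12, ne20, ne30, ne32, if_false, rot_rot, hodd]
    norm_num
    ring

/-! ## §C  The only kill: an exact tie of the twins at the overtaking point (conditional refutation)

`TwinsTiedBelowB1g` and `A1gNeverLeads` are NUMERICAL hypotheses (decided by the T = 0 census, §D);
the implication is kernel-checked.  This is NOT filed `--negative-modulo`: the hypothesis is expected
to be FALSE (twins split by ~1e-4 at `δ*`); it records precisely what an adversary must exhibit. -/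

/-- Triple-point hypothesis: on the window, wherever one of the twins `E`, `B₂g` is at or below `B₁g`,
the twins are exactly tied (for every coupling `U > 0`; for `χ ≠ A1g` both sides scale as `U²`). -/
def TwinsTiedBelowB1g : Prop :=
  ∀ δ ∈ Set.Icc (3/10 : ℝ) (12/25), ∀ U : ℝ, 0 < U →
    (Lam U δ .E ≤ Lam U δ .B1g ∨ Lam U δ .B2g ≤ Lam U δ .B1g) → Lam U δ .E = Lam U δ .B2g

/-- A₁g never strictly leads on the window (census margin `≥ 1.6·10⁻²·U²` above the leader;
the bare `U(∫ψ)²` term only raises `Λ(A1g)`). -/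
def A1gNeverLeads : Prop :=
  ∀ δ ∈ Set.Icc (3/10 : ℝ) (12/25), ∀ U : ℝ, 0 < U → ∃ χ, χ ≠ D4Irrep.A1g ∧ Lam U δ χ ≤ Lam U δ .A1g

/-- CONDITIONAL KILL.  If the twins are tied wherever they reach B₁g (and A₁g never leads), then
`CwKLChiralWindow` is false: clause (ii) at `δ = b` forces the partner `χs` to be STRICTLY below
every other channel by `γU² > 0`, which the tied twin (or, for `χs = A1g`, the hypothesis) forbids;
`χs ∈ {B1g, A2g}` is excluded by the crux itself.  Pure logic over the crux's quantifier structure. -/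
theorem false_of_twinsTied (hT : TwinsTiedBelowB1g) (hA : A1gNeverLeads) :
    ¬ Summit.HubbardSuperconductivity.HubbardSuperconductivity.Theses.ChiralWindow.CwKLChiralWindow := by
  rintro ⟨χs, hB1, hA2, a, b, γ, c, U₁, ha, hab, hb, hγ, hc, hU₁, H⟩
  have hU : U₁ / 2 ∈ Set.Ioo (0:ℝ) U₁ := ⟨by linarith, by linarith⟩
  obtain ⟨h1, h2, h3, h4⟩ := H (U₁ / 2) hU
  have hbI : b ∈ Set.Icc (3/10 : ℝ) (12/25) := ⟨by linarith, hb⟩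
  have hpos : 0 < γ * (U₁ / 2) ^ 2 := by positivity
  cases χs with
  | A1g =>
    obtain ⟨χ, hχ, hle⟩ := hA b hbI (U₁/2) (by linarith)
    have := h2 χ hχ
    change Lam (U₁/2) b .A1g + γ * (U₁ / 2) ^ 2 ≤ Lam (U₁/2) b χ at this
    linarith
  | A2g => exact hA2 rfl
  | B1g => exact hB1 rfl
  | B2g =>
    have hE := h2 .E (by decide)
    have hB := h2 .B1g (by decide)
    change Lam (U₁/2) b .B2g + γ * (U₁ / 2) ^ 2 ≤ Lam (U₁/2) b .E at hE
    change Lam (U₁/2) b .B2g + γ * (U₁ / 2) ^ 2 ≤ Lam (U₁/2) b .B1g at hB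
    have htie := hT b hbI (U₁/2) (by linarith) (Or.inr (by linarith))
    linarith
  | E =>
    have hE := h2 .B2g (by decide)
    have hB := h2 .B1g (by decide)
    change Lam (U₁/2) b .E + γ * (U₁ / 2) ^ 2 ≤ Lam (U₁/2) b .B2g at hE
    change Lam (U₁/2) b .E + γ * (U₁ / 2) ^ 2 ≤ Lam (U₁/2) b .B1g at hB
    have htie := hT b hbI (U₁/2) (by linarith) (Or.inl (by linarith))
    linarith

/-- Upper bound on the isolation margin forced by clause (ii): whatever the partner, `γU²` is at
most the splitting between the partner and ANY other channel at `δ = b`; with the twins this reads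
`γ ≤ |m_E(b) - m_{B2g}(b)|` (census: `~10⁻⁴` near `δ*`, two orders below the in-channel gaps
`~10⁻²`).  Tightness statement for the provers: no certificate with `γ ≳ 10⁻⁴` can exist. -/
theorem gamma_le_twin_split_at_b
    (h : Summit.HubbardSuperconductivity.HubbardSuperconductivity.Theses.ChiralWindow.CwKLChiralWindow) :
    ∃ χs : D4Irrep, χs ≠ .B1g ∧ χs ≠ .A2g ∧ ∃ b γ U₁ : ℝ, 3/10 < b ∧ b ≤ 12/25 ∧ 0 < γ ∧ 0 < U₁ ∧
      ∀ U ∈ Set.Ioo (0:ℝ) U₁, ∀ χ, χ ≠ χs → γ * U ^ 2 ≤ Lam U b χ - Lam U b χs := by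
  obtain ⟨χs, hB1, hA2, a, b, γ, c, U₁, ha, hab, hb, hγ, hc, hU₁, H⟩ := h
  refine ⟨χs, hB1, hA2, b, γ, U₁, by linarith, hb, hγ, hU₁, fun U hU χ hχ => ?_⟩
  obtain ⟨h1, h2, h3, h4⟩ := H U hU
  have := h2 χ hχ
  change Lam U b χs + γ * U ^ 2 ≤ Lam U b χ at this
  linarith

/-! ## §D  Numerical record (T = 0 exact census; filled in as jobs land)

* prior (other seats, T = 0.01 smeared, L = 2048, 512 FS points; tree units):
  `m_B1g - m_E = -7.7e-3 / +4.4e-3 / +1.2e-2` at `n = 0.60 / 0.58 / 0.56`; overtaking `n* ≈ 0.587`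
  (`δ* ≈ 0.413 ∈ [0.30, 0.48]` ✓); `|m_E - m_B2g| ≤ 7.3e-4` on `n ∈ [0.50, 0.60]`, `≈ 1.4e-4` at
  `n*`; A₁g/A₂g `≥ 1.6e-2` above the leader; in-channel gaps `1.07e-2 (B1g), 1.34e-2 (E),
  1.23e-2 (B2g)` at `n = 0.58`; node covering `min_FS(g²+f_x²+f_y²) = 0.15–0.29`.
* refuter T = 0 exact, VALIDATION (jobs j008192, j008607, 2026-08-16): closed-form-1D `χ₀(q)` agrees
  with the doubly-Richardson-extrapolated `T → 0` limit of brute-force finite-T lattice sums (L = 3072,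
  T = .02/.01/.005) to `1e-11 … 7e-10` at 10 generic momenta (`1.4e-7` at one near-Kohn-line point where
  the T-expansion is non-analytic; `1.4e-7` at `|q| = 0.004` where the u-quadrature needs K ≥ 28 —
  irrelevant at the weights such entries carry); symmetry/periodicity exact; `μ_F(FS)/(4π²)` equals
  the elliptic DOS `K(1-μ²/16)/(2π²)` to 10 digits; filling inversion exact to 1e-12.
* refuter T = 0 exact, COARSE CENSUS (j008192, M = 32): `n = 0.60`: B1g -0.025705, B2g -0.018672,
  E -0.018006 (leader B1g, `B1g-E = -7.70e-3` ✓ vs T = .01, `E-B2g = +6.66e-4`); `n = 0.56`: B1g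
  -0.008810, B2g -0.019521, E -0.020376 (leader E, `E-B2g = -8.54e-4`).  (A two-point linear
  interpolation of these suggested a twin crossing at 0.5825 next to a B1g crossing at 0.584 with
  partner B2g — an interpolation artefact, superseded by the M = 128 grid below.)
* refuter T = 0 exact, M = 128 SWEEP (j014411, K = 20, p = 10; n = 0.50 … 0.59; tree units):
  ```
  n      B1g        E          B2g        B1g-E      B1g-B2g    E-B2g      gapB1g  covE    covB2g
  0.500 -0.002293  -0.017644  -0.017969  +1.535e-2  +1.568e-2  +3.248e-4  1.3e-3  0.066   0.0025
  0.520 -0.003262  -0.019569  -0.019205  +1.631e-2  +1.594e-2  -3.644e-4  2.1e-3  0.047   0.0003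
  0.540 -0.006358  -0.020463  -0.019724  +1.410e-2  +1.337e-2  -7.390e-4  4.7e-3  0.051   0.0046
  0.560 -0.008828  -0.020388  -0.019534  +1.156e-2  +1.071e-2  -8.541e-4  6.6e-3  0.038   0.018
  0.570 -0.011042  -0.020044  -0.019272  +9.001e-3  +8.230e-3  -7.714e-4  6.4e-3  0.044   0.012
  0.580 -0.015184  -0.019519  -0.018994  +4.335e-3  +3.810e-3  -5.255e-4  1.0e-2  0.141   0.116
  0.585 -0.017656  -0.019196  -0.018874  +1.540e-3  +1.218e-3  -3.218e-4  1.3e-2  0.185   0.171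
  0.590 -0.020261  -0.018840  -0.018784  -1.421e-3  -1.477e-3  -5.595e-5  1.6e-2  0.223   0.224
  ```
  (A1g⊥ between -0.0125 and -0.0162, A2g between -0.0026 and -0.0065: far above the leader near `n*`,
  by `≥ 6e-3`; M = 32 → 128 drift at n = 0.56: `1.5e-5` on bottoms, `2e-7` on `E-B2g`.)
  READING: local-cubic crossings `n*_E = 0.58762` (B1g = E), `n*_B2g = 0.58726` (B1g = B2g), hence
  `δ* = 0.41238 ∈ [0.30, 0.48]` ✓; the twins cross TWICE, at `n_× ≈ 0.5085` and (extrapolated) at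
  `n_× ≈ 0.591`, with E BELOW B2g in between; at `n*` the lower twin is E with
  `(m_E - m_B2g)(n*) ≈ -1.9e-4` — the T = 0 exact census AGREES with the T = .01 FFT census (j006151:
  `n* ≈ 0.587`, E lower by `1.4e-4`).  So, pending M = 256/512 confirmation: partner `χs = E`,
  `γ ≲ 1.9e-4` (set by B2g at `δ*`; the upper twin crossing at `δ ≈ 0.409 < δ*` is harmless because
  B1g still leads both twins there by `1.4e-3`, and `b` may run up to `12/25`), node covering
  `c ≈ 0.18–0.22` at `n*` (the B1g bottom is nodeless `d⁽⁴⁾`-type on the fundamental arc for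
  `n ≥ 0.57`, `d⁽¹²⁾`-type with 2 extra sign changes for `0.52 ≤ n ≤ 0.56`, where covering with B2g
  degrades to `3e-4` — outside any admissible `[a,b]`).  THE TRIPLE-POINT KILL IS DYING: two
  independent methods put `|m_E - m_B2g|(n*)` at `(1.4–1.9)e-4 ≠ 0`.
* refuter T = 0 exact, M = 128 SWEEP continued (j014412; n = 0.595 … 0.70): B1g leads every channel
  for `n ≥ 0.59`; at `n = 0.70` (`δ = 0.30`, the window's lower end) `B1g-E = -7.13e-2`,
  `B1g-B2g = -7.54e-2`, A1g⊥ -0.0167, A2g -0.0039 vs B1g -0.0912 (clause (i) margin `≥ 7e-2` ✓ card);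
  twin crossings (local cubic) at `n = 0.50847, 0.59094, 0.66679`.
* refuter T = 0 exact, M = 256 GRID (j014414/j014415/j014417, K = 24, p = 10; step 0.001):
  ```
  n      B1g        E          B2g        B1g-E      B1g-B2g    E-B2g      gapB1g  gapE    covE    covB2g
  0.580 -0.015186  -0.019519  -0.018994  +4.333e-3  +3.808e-3  -5.248e-4  1.0e-2  1.3e-2  0.141   0.116
  0.581 -0.015667  -0.019458  -0.018969  +3.791e-3  +3.302e-3  -4.888e-4  1.1e-2  1.3e-2  0.150   0.127
  0.582 -0.016155  -0.019395  -0.018945  +3.240e-3  +2.790e-3  -4.505e-4  1.1e-2  1.2e-2  0.159   0.138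
  0.583 -0.016650  -0.019331  -0.018921  +2.680e-3  +2.270e-3  -4.099e-4  1.2e-2  1.2e-2  0.168   0.149
  0.584 -0.017151  -0.019265  -0.018898  +2.114e-3  +1.747e-3  -3.667e-4  1.2e-2  1.2e-2  0.176   0.160
  0.585 -0.017659  -0.019197  -0.018876  +1.539e-3  +1.217e-3  -3.215e-4  1.3e-2  1.2e-2  0.185   0.171
  0.586 -0.018169  -0.019128  -0.018855  +9.596e-4  +6.859e-4  -2.737e-4  1.3e-2  1.2e-2  0.193   0.182
  0.587 -0.018686  -0.019059  -0.018836  +3.725e-4  +1.494e-4  -2.231e-4  1.4e-2  1.2e-2  0.201   0.192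
  0.588 -0.019206  -0.018987  -0.018816  -2.194e-4  -3.900e-4  -1.706e-4  1.5e-2  1.1e-2  0.208   0.203
  ```
  M = 128 → 256 drift: at `n = 0.580` `1.8e-6` on `B1g-E`, `6.4e-7` on `E-B2g`; at `n = 0.585` `1.3e-6` /
  `3.1e-7` (absolute, tree units).  Crossings (local cubics on the 0.001 grid): `n*_E = 0.5876307`
  (M = 128: 0.5876314), `n*_B2g = 0.5872782` (0.5872799), `(m_E - m_B2g)(n*_E) = -1.902e-4` (M = 128:
  -1.894e-4); A1g⊥/A2g `≥ 5.9e-3 / 1.4e-2` above the leader throughout `[0.580, 0.588]`.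
* VERDICT by the pre-registered rule: `|m_E - m_B2g|(n*) = 1.90e-4 ≥ 100 ×` drift ⇒ the
  triple-point kill is DEAD; the crux is numerically TRUE.  WITNESS SKETCH for the provers (tree
  units): `χs = E`; `a = 3/10`; `b ∈ [0.4125, 0.4127]` (at `δ = b` E leads B1g by ≥ 1e-4 once
  `δ ≥ δ*_E + 1.7e-4`, slope `d(m_B1g - m_E)/dn ≈ 0.59`, and leads B2g by ≈ 1.9e-4); `γ = 1.0e-4`
  (binding constraints: B2g vs B1g just below `δ*_E`, B2g vs E just above; A1g⊥, A2g slack ≥ 5e-3;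
  the twin crossing at `δ = 0.409` is harmless since B1g leads both twins there by 1.4e-3);
  `c ≈ 0.15` (`min_FS(g² + f_x² + f_y²) = 0.20` at `n*`, B1g bottom nodeless `d⁽⁴⁾`-type,
  `f_x² + f_y² = 1.05` on the diagonal); `U₁`: any value making `Λ(A1g;U)/U²` within 5e-3 of its
  limit `m_{A1g}^⊥`.  PRICE: (ii)/(iii) need certified absolute accuracy `≤ 3e-5` on `m_B1g, m_E,
  m_B2g` for `n ∈ [0.586, 0.589]` — in-channel gaps there are `1.4e-2 / 1.15e-2 / 1.19e-2`, so
  gap-squared (Temple) enclosures need trial residuals `≲ 5e-4`.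
* STILL QUEUED at the time of writing: j014426 (M = 256 at n = .579/.589/.590, M = 512 at
  n = .581/.583/.585, M = 128 remainder) — an M-convergence addendum; its summary auto-attaches to
  the item.  Nothing in the verdict depends on it (M = 128 → 256 drift is already 100× below the
  splitting).
-/

/-! ## §E  Repair candidate (NOT asserted; recorded for the planner in case §C's hypothesis holds
numerically to all accessible precision)

If the twins cannot be separated (exact or practically exact tie at `δ*`), the certifiable content
of the census is the CLUSTER statement below: B₁g is overtaken inside the window by the pair
`{E, B2g}`, the far channels `A1g, A2g` stay `γU²` above the running minimum, and B₁g is fully gapped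
with EACH twin's bottom eigenspace.  Prior census margins for it are `≥ 4·10⁻³` (vs `10⁻⁴` for the
crux as filed).  Whether a three-component near-degenerate condensate still yields the route's
massive infrared is a question for `CwChiralConstruction`, not settled here. -/

/-- Cluster form of the chiral-window data (repair candidate C′; same objects as the crux). -/
def ClusterWindow : Prop :=
  ∃ a b γ c U₁ : ℝ, 3/10 ≤ a ∧ a < b ∧ b ≤ 12/25 ∧ 0 < γ ∧ 0 < c ∧ 0 < U₁ ∧
    ∀ U ∈ Set.Ioo (0:ℝ) U₁,
    let ε : Momentum → ℝ := squareDispersion 1 0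
    let μ : ℝ → ℝ := fun δ => chemicalPotentialOfDensity ε (1 - δ)
    let Λ : ℝ → D4Irrep → ℝ := fun δ χ => channelInf ε (μ δ) U χ
    -- (i) at δ = a, B1g leads every channel by γU²
    (∀ χ, χ ≠ D4Irrep.B1g → Λ a .B1g + γ * U ^ 2 ≤ Λ a χ) ∧
    -- (ii') at δ = b, the twin cluster leads B1g and the far channels by γU²
    (∀ χ, χ ≠ D4Irrep.E → χ ≠ D4Irrep.B2g → min (Λ b .E) (Λ b .B2g) + γ * U ^ 2 ≤ Λ b χ) ∧
    -- (iii') on [a,b] the far channels stay γU² above the running minimum of {B1g, E, B2g}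
    (∀ δ ∈ Set.Icc a b, ∀ χ, χ = D4Irrep.A1g ∨ χ = D4Irrep.A2g →
      min (Λ δ .B1g) (min (Λ δ .E) (Λ δ .B2g)) + γ * U ^ 2 ≤ Λ δ χ) ∧
    -- (iv') node covering of the B1g bottom with EACH twin's bottom eigenspace
    (∀ δ ∈ Set.Icc a b, ∀ χt, χt = D4Irrep.E ∨ χt = D4Irrep.B2g →
      ∃ (g : Momentum → ℝ) (n : ℕ) (f : Fin n → Momentum → ℝ),
        IsChannelState ε (μ δ) .B1g g ∧ pairingForm ε (μ δ) U g = Λ δ .B1g ∧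
        (∀ i, IsChannelState ε (μ δ) χt (f i) ∧ pairingForm ε (μ δ) U (f i) = Λ δ χt) ∧
        (Pairwise fun i j => ∫ k, f i k * f j k ∂fermiCurveMeasure ε (μ δ) = 0) ∧
        ∀ᵐ k ∂fermiCurveMeasure ε (μ δ), c ≤ g k ^ 2 + ∑ i, f i k ^ 2)

-- Note: `ClusterWindow` is not implied by the crux as filed ((iv') asks node covering with BOTH
-- twins) nor does it imply it (no twin separation); it is the intended direction of repair only.

/-! ## Targets
(none yet: payload `stuck_stubs = []`, no skeleton registered for this crux) -/

end Summit.HubbardSuperconductivity.HubbardSuperconductivity.Cruxes.CwKLChiralWindow.Disproof
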